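import Summits.CriticalPhenomena.SAWScalingLimit.Theorems.SAWDevelopingMapHexTransferYbRelayDefs
import Summits.CriticalPhenomena.SAWScalingLimit.Theorems.SAWDevelopingMapHexTransferCompassEndpointsFaceChains
import Literature.Probability.RandomPlanarGeometry.YangBaxterSAWHexBridges

/-!
# The `π/3` dictionary, part I: triangle lists of Yang–Baxter walks and their decoding

Helper file of the line `yb-relay` for the crux `HexTransfer` (stmt-CriticalPhenomena-14221), stub
`stub_gmHexDictionary` (the exact "Glazman–Manolescu walk at `Θ ≡ π/3` = hexagonal SAW" dictionary,
A. Glazman, I. Manolescu, arXiv:1708.00395, §1 p. 3 and Fig. 2), combinatorial half, in the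
coordinate honeycomb `HV` of `HexSAWLattice.lean` and the chart `Face.hv` of
`YangBaxterSAWHexBridges.lean` (face `(k, j)`, side `s` ↦ triangle `(-j, k, s.tri)`):

* `faceHV v` — the rhombus containing the triangle `v`; `arcTris p`, `listTris l` — the triangles
  crossed by an arc / by a list of mid-edges, as plain list functions, with
  `YBWalk.hvInner_eq_listTris` (the triangle list `hvInner` of `YangBaxterSAWHexBridges.lean` is
  `listTris` of the mid-edge list);
* `hvGraph_adj_cases` — a honeycomb edge is either the short diagonal of a rhombus or dual to a
  common side of two different rhombi;
* `listTris_decode` — **decoding**: for a self-avoiding honeycomb vertex list `t :: R` entered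
  through the side `s` of the rhombus of `t` and left through the boundary edge `b`, the mid-edge list
  `f.side s :: pairEdges (t :: R) ++ [b]` (the sides crossed, `YBWalk.pairEdges`) has all its arcs in
  rhombi of the domain, consecutive arcs in different rhombi, and its triangle list is `t :: R` again
  (up to the entry triangle) — the surjectivity half of the dictionary.

Elementary combinatorics of the square grid and its triangulation; tagged [folklore] / cited to
Glazman–Manolescu where it is their Fig. 2.
-/

namespace Summit.CriticalPhenomena.SAWScalingLimit.Cruxes.HexTransfer.YbRelay

open Literature.Probability.RandomPlanarGeometry
open Literature.Probability.RandomPlanarGeometry.SAW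
open Literature.Probability.RandomPlanarGeometry.SAW.YangBaxter

/-! ### The rhombus of a triangle -/

/-- The rhombus `(k, j)` containing the triangle `v = (-j, k, b)` of the coordinate honeycomb (inverse
of the chart `Face.hv (k, j) s = (-j, k, s.tri)`). [cite: GlazmanManolescu2019, §1, Fig. 2] -/
def faceHV (v : HV) : Face := (v.2.1, -v.1)

/-- The rhombus of the triangle of a side of `f` is `f`. [folklore] -/
@[simp] theorem faceHV_hv (f : Face) (s : Side) : faceHV (f.hv s) = f := by
  obtain ⟨k, j⟩ := f
  simp [faceHV, Face.hv]

/-- A triangle is `f.hv s` iff it lies in `f` with the type of `s`. [folklore] -/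
theorem hv_eq_iff (f : Face) (s : Side) (v : HV) : f.hv s = v ↔ f = faceHV v ∧ s.tri = v.2.2 := by
  obtain ⟨k, j⟩ := f
  obtain ⟨x, y, c⟩ := v
  simp only [Face.hv, faceHV, Prod.mk.injEq]
  constructor
  · rintro ⟨rfl, rfl, rfl⟩
    exact ⟨⟨rfl, by ring⟩, rfl⟩
  · rintro ⟨⟨rfl, rfl⟩, rfl⟩
    exact ⟨by ring, rfl, rfl⟩

/-- Every triangle is a triangle of its rhombus. [folklore] -/
theorem hv_faceHV (v : HV) (s : Side) (hs : s.tri = v.2.2) : (faceHV v).hv s = v :=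
  (hv_eq_iff _ _ _).2 ⟨rfl, hs⟩

/-- The side `W` or `S` of the rhombus of `v` carrying `v`. [folklore] -/
def triSide (v : HV) : Side := if v.2.2 then .S else .W

/-- `triSide v` has the type of `v`. [folklore] -/
@[simp] theorem tri_triSide (v : HV) : (triSide v).tri = v.2.2 := by
  unfold triSide
  cases v.2.2 <;> rfl

/-- Every triangle is `(faceHV v).hv (triSide v)`. [folklore] -/
theorem hv_triSide (v : HV) : (faceHV v).hv (triSide v) = v :=
  hv_faceHV v _ (tri_triSide v)

/-! ### Triangle lists as list functions -/

/-- The triangles crossed by an arc `p = (e, e')`, read off its face and end-sides (one triangle for a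
corner arc, two otherwise; junk for a non-arc). [cite: GlazmanManolescu2019, §1, Fig. 2] -/
def arcTris (p : MidEdge × MidEdge) : List HV :=
  if (sideIn p).tri = (sideOut p).tri then [(faceOf p).hv (sideIn p)]
  else [(faceOf p).hv (sideIn p), (faceOf p).hv (sideOut p)]

/-- The triangles crossed along a list of mid-edges: the concatenation of the triangles of its arcs.
[cite: GlazmanManolescu2019, §1, Fig. 2] -/
def listTris (l : List MidEdge) : List HV := (arcsOf l).flatMap arcTris

/-- `listTris` of a list with at least two elements. [folklore] -/
theorem listTris_cons_cons (e e' : MidEdge) (l : List MidEdge) :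
    listTris (e :: e' :: l) = arcTris (e, e') ++ listTris (e' :: l) := by
  simp [listTris, arcsOf, List.flatMap_cons]

/-- An arc crosses at least one triangle. [folklore] -/
theorem arcTris_ne_nil (p : MidEdge × MidEdge) : arcTris p ≠ [] := by
  unfold arcTris; split_ifs <;> simp

/-- The first triangle of an arc is the one of its entry side. [folklore] -/
theorem head_arcTris (p : MidEdge × MidEdge) :
    (arcTris p).head (arcTris_ne_nil p) = (faceOf p).hv (sideIn p) := by
  unfold arcTris; split_ifs <;> rfl

/-- The entry triangle belongs to the arc. [folklore] -/
theorem hv_sideIn_mem_arcTris (p : MidEdge × MidEdge) : (faceOf p).hv (sideIn p) ∈ arcTris p := by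
  unfold arcTris; split_ifs <;> simp

/-- The exit triangle belongs to the arc. [folklore] -/
theorem hv_sideOut_mem_arcTris (p : MidEdge × MidEdge) : (faceOf p).hv (sideOut p) ∈ arcTris p := by
  unfold arcTris
  split_ifs with h
  · simp only [List.mem_singleton]
    exact Face.hv_eq_hv_iff.2 ⟨rfl, h.symm⟩
  · simp

/-- The last triangle of an arc is the one of its exit side. [folklore] -/
theorem getLast_arcTris (p : MidEdge × MidEdge) :
    (arcTris p).getLast (arcTris_ne_nil p) = (faceOf p).hv (sideOut p) := by
  unfold arcTris
  split_ifs with h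
  · simp only [List.getLast_singleton]
    exact Face.hv_eq_hv_iff.2 ⟨rfl, h⟩
  · simp

/-- The triangles of an arc lie in its face. [folklore] -/
theorem faceHV_of_mem_arcTris {p : MidEdge × MidEdge} {v : HV} (hv : v ∈ arcTris p) : faceHV v = faceOf p := by
  unfold arcTris at hv
  split_ifs at hv <;> simp at hv <;> rcases hv with rfl | rfl <;> simp

/-- A non-corner arc crosses both triangles of its rhombus. [folklore] -/
theorem mem_arcTris_of_tri_ne {p : MidEdge × MidEdge} (h : (sideIn p).tri ≠ (sideOut p).tri) (s : Side) :
    (faceOf p).hv s ∈ arcTris p := by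
  unfold arcTris
  rw [if_neg h]
  simp only [List.mem_cons, List.not_mem_nil, or_false, Face.hv_eq_hv_iff, true_and]
  revert h
  cases (sideIn p).tri <;> cases (sideOut p).tri <;> cases s.tri <;> decide

namespace YBWalk

variable {D : Set Face} {a z : MidEdge} (γ : YBWalk D a z)

/-- `arcHV` is `arcTris` of the arc. [folklore] -/
theorem arcHV_eq_arcTris (i : ℕ) : γ.arcHV i = arcTris (γ.arcAt i) := rfl

/-- `hvUpTo i` is the concatenation of the triangles of the first `i` arcs. [folklore] -/
theorem hvUpTo_eq_flatMap {i : ℕ} (hi : i ≤ γ.arcs.length) :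
    γ.hvUpTo i = (γ.arcs.take i).flatMap arcTris := by
  induction i with
  | zero => rfl
  | succ i ih =>
    show γ.hvUpTo i ++ γ.arcHV i = _
    rw [ih (by omega), List.take_succ_eq_append_getElem (by omega), List.flatMap_append,
      List.flatMap_cons, List.flatMap_nil, List.append_nil, arcHV_eq_arcTris, YBWalk.arcAt,
      List.getD_eq_getElem' hi]
    rfl

/-- **The triangle list of a walk is `listTris` of its mid-edges.** [folklore] -/
theorem hvInner_eq_listTris : γ.hvInner = listTris γ.mids := by
  rw [YBWalk.hvInner, hvUpTo_eq_flatMap γ le_rfl, List.take_length]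
  rfl

end YBWalk


/-! ### Honeycomb edges: short diagonals and side crossings -/

/-- **A honeycomb edge is a short diagonal or dual to a common side of two different rhombi.**
[cite: GlazmanManolescu2019, §1, Fig. 2] -/
theorem hvGraph_adj_cases {v w : HV} (h : hvGraph.Adj v w) :
    (faceHV w = faceHV v ∧ w.2.2 = !v.2.2) ∨
      ∃ s t : Side, (faceHV v).side s = (faceHV w).side t ∧ faceHV v ≠ faceHV w ∧
        s.tri = v.2.2 ∧ t.tri = w.2.2 := by
  obtain ⟨x, y, c⟩ := v
  obtain ⟨x', y', c'⟩ := w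
  rw [hvGraph_adj, HV.AdjRel] at h
  dsimp only at h
  simp only [faceHV, ne_eq, Prod.mk.injEq]
  cases c <;> cases c' <;> simp only [Bool.false_eq_true, Bool.true_eq_false, false_and, and_false,
    or_false, false_or, true_and, or_self] at h
  · rcases h with ⟨h1, h2⟩ | ⟨h1, h2⟩ | ⟨h1, h2⟩
    · exact Or.inl ⟨⟨h2, by rw [h1]⟩, rfl⟩
    · exact Or.inr ⟨.N, .S, by simp only [Face.side, MidEdge.slant.injEq]; omega, by omega, rfl, rfl⟩
    · exact Or.inr ⟨.W, .E, by simp only [Face.side, MidEdge.vert.injEq]; omega, by omega, rfl, rfl⟩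
  · rcases h with ⟨h1, h2⟩ | ⟨h1, h2⟩ | ⟨h1, h2⟩
    · exact Or.inl ⟨⟨h2, by rw [h1]⟩, rfl⟩
    · exact Or.inr ⟨.S, .N, by simp only [Face.side, MidEdge.slant.injEq]; omega, by omega, rfl, rfl⟩
    · exact Or.inr ⟨.E, .W, by simp only [Face.side, MidEdge.vert.injEq]; omega, by omega, rfl, rfl⟩

/-- Two different rhombi with a common side: the second rhombus in terms of the first. [folklore] -/
theorem side_eq_side_cases' {f g : Face} {σ s : Side} (h : g.side s = f.side σ) (hg : g ≠ f) :
    (σ = .E ∧ s = .W ∧ g = (f.1 + 1, f.2)) ∨ (σ = .W ∧ s = .E ∧ g = (f.1 - 1, f.2)) ∨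
      (σ = .N ∧ s = .S ∧ g = (f.1, f.2 + 1)) ∨ (σ = .S ∧ s = .N ∧ g = (f.1, f.2 - 1)) := by
  obtain ⟨k, j⟩ := f
  obtain ⟨k', j'⟩ := g
  cases s <;> cases σ <;>
    simp only [Face.side, MidEdge.vert.injEq, MidEdge.slant.injEq, reduceCtorEq, Prod.mk.injEq,
      ne_eq, not_and] at h hg ⊢ <;> simp <;> omega

/-- **A mid-edge is a side of exactly two rhombi**: the incidence other than `(f, σ)` is unique.
[folklore] -/
theorem incidence_unique {f g g' : Face} {σ s s' : Side} (h : g.side s = f.side σ) (hg : g ≠ f)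
    (h' : g'.side s' = f.side σ) (hg' : g' ≠ f) : g' = g ∧ s' = s := by
  rcases side_eq_side_cases' h hg with ⟨rfl, rfl, rfl⟩ | ⟨rfl, rfl, rfl⟩ | ⟨rfl, rfl, rfl⟩ | ⟨rfl, rfl, rfl⟩ <;>
    rcases side_eq_side_cases' h' hg' with ⟨h1, rfl, rfl⟩ | ⟨h1, rfl, rfl⟩ | ⟨h1, rfl, rfl⟩ | ⟨h1, rfl, rfl⟩ <;>
    first | exact ⟨rfl, rfl⟩ | exact absurd h1 (by decide)

/-- The face and end-sides of the arc between two distinct sides of a rhombus. [folklore] -/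
theorem faceOf_side_side (f : Face) {s t : Side} (hst : s ≠ t) :
    faceOf (f.side s, f.side t) = f ∧ sideIn (f.side s, f.side t) = s ∧ sideOut (f.side s, f.side t) = t := by
  have h := Sketch.Endpoints.arcFace_side_side f hst
  obtain ⟨h1, h2, -⟩ := side_sideIn h
  exact ⟨faceOf_eq h, Face.side_injective f h1, Face.side_injective f h2⟩

/-- The triangles of the arc between two distinct sides of a rhombus. [cite: GlazmanManolescu2019, §1, Fig. 2] -/
theorem arcTris_side_side (f : Face) {s t : Side} (hst : s ≠ t) :
    arcTris (f.side s, f.side t) = if s.tri = t.tri then [f.hv s] else [f.hv s, f.hv t] := by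
  obtain ⟨h1, h2, h3⟩ := faceOf_side_side f hst
  simp only [arcTris, h1, h2, h3]

/-- On a boundary edge of `Δ` rests only one rhombus of `Δ`. [folklore] -/
theorem IsBdryEdge.face_unique {Δ : Set Face} {e : MidEdge} (h : IsBdryEdge Δ e) {g g' : Face}
    {s s' : Side} (hg : g.side s = e) (hgΔ : g ∈ Δ) (hg' : g'.side s' = e) (hg'Δ : g' ∈ Δ) : g' = g := by
  have h1 := (Face.exists_side_eq_iff g e).1 ⟨s, hg⟩
  have h2 := (Face.exists_side_eq_iff g' e).1 ⟨s', hg'⟩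
  unfold IsBdryEdge at h
  rcases h1 with rfl | rfl <;> rcases h2 with rfl | rfl <;> tauto

/-- The rhombus of `Δ` resting on a boundary edge `e` is `inclFace Δ e`, and it has `e` as a side.
[folklore] -/
theorem IsBdryEdge.inclFace_spec {Δ : Set Face} {e : MidEdge} (h : IsBdryEdge Δ e) :
    inclFace Δ e ∈ Δ ∧ ∃ s, (inclFace Δ e).side s = e := by
  unfold IsBdryEdge at h
  unfold inclFace
  split_ifs with h1
  · exact ⟨h1, (Face.exists_side_eq_iff _ e).2 (Or.inl rfl)⟩
  · exact ⟨by tauto, (Face.exists_side_eq_iff _ e).2 (Or.inr rfl)⟩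

/-- A rhombus of `Δ` resting on the boundary edge `e` is `inclFace Δ e`. [folklore] -/
theorem IsBdryEdge.eq_inclFace {Δ : Set Face} {e : MidEdge} (h : IsBdryEdge Δ e) {g : Face} {s : Side}
    (hg : g.side s = e) (hgΔ : g ∈ Δ) : g = inclFace Δ e := by
  obtain ⟨h1, s', h2⟩ := h.inclFace_spec
  exact h.face_unique h2 h1 hg hgΔ

/-- `pairEdges` of a list with at least two triangles. [folklore] -/
theorem pairEdges_cons_cons (v w : HV) (l : List HV) :
    YBWalk.pairEdges (v :: w :: l) = (edgeOf v w).toList ++ YBWalk.pairEdges (w :: l) := rfl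

/-! ### Decoding a honeycomb path into a Yang–Baxter walk -/

/-- **Decoding lemma.** Let `t :: R` be a self-avoiding honeycomb path (coordinate model) all of whose
triangles lie in rhombi of `Δ`, currently in the rhombus `f` of `t`, entered through the side `s`
of `f` (the triangle beyond `f.side s` and, if already left, the entry triangle `f.hv s` are not
revisited), ending on the triangle resting on the boundary edge `b ≠ f.side s` of `Δ`. Then the
mid-edge list `f.side s :: pairEdges (t :: R) ++ [b]` (entry side, sides crossed, exit side) has all
its arcs in rhombi of `Δ`, consecutive arcs in different rhombi, its first arc in `f`, and its
triangle list is `t :: R` preceded by the entry triangle if `t ≠ f.hv s`. This is the statement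
"each rhombus is crossed as in Fig. 2" read backwards. [cite: GlazmanManolescu2019, §1 p. 3, Fig. 2] -/
theorem listTris_decode {Δ : Set Face} {b : MidEdge} (hb : IsBdryEdge Δ b) :
    ∀ (R : List HV) (f : Face) (s : Side) (t : HV),
      (t :: R).IsChain hvGraph.Adj → (t :: R).Nodup → faceHV t = f →
      (∀ (g : Face) (s' : Side), g.side s' = f.side s → g ≠ f → g.hv s' ∉ R) →
      (s.tri ≠ t.2.2 → f.hv s ∉ R) →
      (∃ (g : Face) (s' : Side), g.side s' = b ∧ (t :: R).getLast (List.cons_ne_nil t R) = g.hv s') →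
      b ≠ f.side s → (∀ v ∈ t :: R, faceHV v ∈ Δ) →
      listTris (f.side s :: (YBWalk.pairEdges (t :: R) ++ [b])) =
          (if s.tri = t.2.2 then [] else [f.hv s]) ++ t :: R ∧
        (∀ p ∈ arcsOf (f.side s :: (YBWalk.pairEdges (t :: R) ++ [b])), ∃ g ∈ Δ, arcFace p = some g) ∧
        (arcsOf (f.side s :: (YBWalk.pairEdges (t :: R) ++ [b]))).IsChain (fun p q => arcFace p ≠ arcFace q) ∧
        ∀ e' ∈ (YBWalk.pairEdges (t :: R) ++ [b]).head?, arcFace (f.side s, e') = some f := by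
  intro R
  induction R with
  | nil =>
    intro f s t _ _ hft _ _ hlast hbs hΔ
    obtain ⟨g, s', hgs', hlast⟩ := hlast
    rw [List.getLast_singleton] at hlast
    subst hlast
    rw [faceHV_hv] at hft
    subst hft
    rw [← hgs'] at hbs ⊢
    have hss' : s ≠ s' := fun h => hbs (by rw [h])
    have hf : arcFace (g.side s, g.side s') = some g := Sketch.Endpoints.arcFace_side_side g hss'
    simp only [YBWalk.pairEdges_singleton, List.nil_append, listTris_cons_cons, arcTris_side_side g hss',
      List.head?_cons, Option.mem_def, Option.some.injEq, forall_eq']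
    refine ⟨?_, ?_, ?_, hf⟩
    · show _ ++ listTris [g.side s'] = _
      have h0 : listTris [g.side s'] = [] := rfl
      rw [h0, List.append_nil]
      change (if s.tri = s'.tri then [g.hv s] else [g.hv s, g.hv s']) =
        (if s.tri = s'.tri then [] else [g.hv s]) ++ [g.hv s']
      split_ifs with h
      · rw [List.nil_append, List.cons.injEq]
        exact ⟨Face.hv_eq_hv_iff.2 ⟨rfl, h⟩, rfl⟩
      · rfl
    · intro p hp
      have : p = (g.side s, g.side s') := by simpa [arcsOf] using hp
      subst this
      exact ⟨g, by simpa using hΔ (g.hv s') (by simp), hf⟩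
    · exact List.IsChain.singleton _
  | cons t' R' ih =>
    intro f s t hchain hnodup hft hu hback hlast hbs hΔ
    rw [List.isChain_cons_cons] at hchain
    obtain ⟨hadj, hchain'⟩ := hchain
    rw [List.nodup_cons] at hnodup
    obtain ⟨htmem, hnodup'⟩ := hnodup
    have hlast' : ∃ (g : Face) (s' : Side), g.side s' = b ∧
        (t' :: R').getLast (List.cons_ne_nil t' R') = g.hv s' := by
      obtain ⟨g, s', h1, h2⟩ := hlast
      exact ⟨g, s', h1, by rwa [List.getLast_cons (List.cons_ne_nil t' R')] at h2⟩
    have hΔ' : ∀ v ∈ t' :: R', faceHV v ∈ Δ := fun v hv => hΔ v (List.mem_cons_of_mem _ hv)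
    have hfΔ : f ∈ Δ := hft ▸ hΔ t (by simp)
    rcases hvGraph_adj_cases hadj with ⟨hff', htt'⟩ | ⟨σ, σ', hσ, hff', hσt, hσt'⟩
    · -- the short diagonal: stay in `f`
      rw [hft] at hff'
      have hs : s.tri = t.2.2 := by
        by_contra hs
        apply hback hs
        have : f.hv s = t' := (hv_eq_iff f s t').2 ⟨hff'.symm, by
          rw [htt']; revert hs; cases s.tri <;> cases t.2.2 <;> decide⟩
        rw [this]; exact List.mem_cons_self
      have hts : f.hv s = t := (hv_eq_iff f s t).2 ⟨hft.symm, hs⟩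
      have hpe : YBWalk.pairEdges (t :: t' :: R') = YBWalk.pairEdges (t' :: R') := by
        rw [pairEdges_cons_cons, ← hv_triSide t, ← hv_triSide t', hft, hff', edgeOf_hv_hv]
        rfl
      obtain ⟨h1, h2, h3, h4⟩ := ih f s t' hchain' hnodup' hff'
        (fun g s' hg hne hmem => hu g s' hg hne (List.mem_cons_of_mem _ hmem))
        (fun _ hmem => htmem (hts ▸ List.mem_cons_of_mem _ hmem)) hlast' hbs hΔ'
      rw [hpe, if_pos hs]
      refine ⟨?_, h2, h3, h4⟩
      rw [h1, if_neg (by rw [htt', hs]; cases t.2.2 <;> decide), hts]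
      rfl
    · -- crossing the side `f.side σ = f'.side σ'` into the rhombus `f'` of `t'`
      rw [hft] at hσ hff'
      set f' := faceHV t' with hf'
      have ht : f.hv σ = t := (hv_eq_iff f σ t).2 ⟨hft.symm, hσt⟩
      have ht' : f'.hv σ' = t' := (hv_eq_iff f' σ' t').2 ⟨rfl, hσt'⟩
      have hsσ : s ≠ σ := by
        rintro rfl
        exact hu f' σ' hσ.symm (Ne.symm hff') (by rw [ht']; exact List.mem_cons_self)
      have hpe : YBWalk.pairEdges (t :: t' :: R') = f'.side σ' :: YBWalk.pairEdges (t' :: R') := by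
        rw [pairEdges_cons_cons, ← ht, ← ht', edgeOf_of_side_eq hσ hff', hσ]
        rfl
      have hbs' : b ≠ f'.side σ' := by
        intro hb'
        have h1 : f'.side σ' = b := hb'.symm
        have h2 : f.side σ = b := hσ.trans h1
        exact hff' (hb.face_unique h1 (hΔ' t' (by simp)) h2 hfΔ)
      obtain ⟨h1, h2, h3, h4⟩ := ih f' σ' t' hchain' hnodup' rfl
        (fun g s'' hg hne hmem => by
          obtain ⟨rfl, rfl⟩ := incidence_unique hσ hff' hg hne
          exact htmem (ht ▸ List.mem_cons_of_mem _ hmem))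
        (fun h => absurd hσt' h) hlast' hbs' hΔ'
      have hfa : arcFace (f.side s, f'.side σ') = some f := by rw [← hσ]; exact Sketch.Endpoints.arcFace_side_side f hsσ
      rw [hpe, List.cons_append, listTris_cons_cons, h1, if_pos hσt', List.nil_append, arcsOf_cons_cons]
      refine ⟨?_, ?_, ?_, ?_⟩
      · rw [← hσ, arcTris_side_side f hsσ, ← ht]
        change _ = (if s.tri = σ.tri then [] else [f.hv s]) ++ f.hv σ :: t' :: R'
        split_ifs with h
        · rw [Face.hv_eq_hv_iff.2 ⟨rfl, h⟩]; rfl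
        · rfl
      · intro p hp
        rcases List.mem_cons.1 hp with rfl | hp
        · exact ⟨f, hfΔ, hfa⟩
        · exact h2 p hp
      · refine List.IsChain.cons h3 fun q hq => ?_
        obtain ⟨e'', l'', hel⟩ : ∃ e'' l'', YBWalk.pairEdges (t' :: R') ++ [b] = e'' :: l'' :=
          List.exists_cons_of_ne_nil (by simp)
        rw [hel, arcsOf_cons_cons, List.head?_cons, Option.mem_def, Option.some.injEq] at hq
        subst hq
        rw [hfa, h4 e'' (by rw [hel]; rfl)]
        exact fun h => hff' (Option.some_injective _ h)
      · intro e' he'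
        rw [List.head?_cons, Option.mem_def, Option.some.injEq] at he'
        subst he'
        exact hfa

/-- **Main statement of this file (registered sub-goal of `stub_gmHexDictionary`)**: the triangle list
of a Yang–Baxter walk is `listTris` of its mid-edge list. [folklore] -/
theorem hvInner_eq_listTris_mids : ∀ {D : Set Face} {a z : MidEdge} (γ : YBWalk D a z), γ.hvInner = listTris γ.mids := by
  intro D a z γ
  exact YBWalk.hvInner_eq_listTris γ

end Summit.CriticalPhenomena.SAWScalingLimit.Cruxes.HexTransfer.YbRelay
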